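import Mathlib
import HarnessLib
import Summits.HubbardSuperconductivity.HubbardSuperconductivity.Theorems.KLProgrammeKLRegimeCountertermJacksonRemainderCertAnChart
import Summits.HubbardSuperconductivity.HubbardSuperconductivity.Theorems.KLProgrammeKLRegimeCountertermJacksonRemainderCertAnalyticCutoff

/-!
# (C1) ANALYTIC CERTIFICATE at deep scales, part 2 — the NEAR-FIELD angular rows (`Tt`, `Tu`, `Td`) of the certificate

Cell `gate-hubbard-kl`, seat hubbard-kl-k3c3-p3 (g12), `--supports stmt-HubbardSuperconductivity-20437` (stub (C) of `KLRegimeEngineV17F2`),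
located item «(C1)-DEEP-AN» (KL STATUS 2026-08-27T23:50Z).  Part 1 (`…CertAnChart`) controls the displaced polar angle through the rotated
argument chart `Ψ_θ`; this file TRANSFERS those jets to the certificate's own object `certAngle r w = polarAngle ∘ centredRep ∘ (certCurve r − v_w)`
(k3c3-p1, `…CertDefs`) on the NEAR SQUARE `|s|, |t| ≤ δ₀` of displacements `w = (s, t)`, and states the near-field rows:

* §1 transfer (for `r ∈ C⁴`, `r θ = u > 0`, `4δ₀ < u`, `u + 2δ₀ < π`, and the displaced base point OFF THE CUT — k3c3-p1's a.e. condition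
  `ae_jmeas_offGridSlit`): `certAngle r w = Ψ_θ(certCurve r · − v_w) + 2πk` near `θ` (no fold on the near square; both are continuous angle
  functions of the same point; the integer is locally constant), hence `∂ᵐ certAngle r w (θ) = ∂ᵐ[Ψ_θ ∘ …](θ)` (`m ≥ 1`) and
  `⟨certAngle r w θ − θ⟩ = Ψ_θ(…) − θ`;
* §2 **the near-field rows**, with `L = |s| + |t|` (`≥ ‖v_w‖`), `ρ ≤ u − 2δ₀` and the curve jets `‖(certCurve r)^{(i)}(θ)‖ ≤ D i`:
  `|α′ − 1| ≤ Λ₁L`, `|α″| ≤ Λ₂L`, `|α‴| ≤ Λ₃L`, `|α⁗| ≤ Λ₄L` (part 1's `Λ_m(D, ρ)`); the lower Bell rows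
  `P_{k,l}(X_w) ≤ Tn_{k,l}·L` (`l < k`), the top-coefficient rows `|α′ᵏ − 1| ≤ k·Λ₁(1 + 2δ₀Λ₁)ᵏ·L`, and the transport row
  `|⟨α_w(θ) − θ⟩| ≤ |−sin θ·s + cos θ·t|/(u − 2δ₀)` — each multiplied by `|χ_w(θ)| ≤ 1` as the certificate asks.

Pure real analysis on the certificate vocabulary; no definitions; nothing about the Hubbard model.
-/

noncomputable section

namespace Summit.HubbardSuperconductivity.HubbardSuperconductivity.Theorems.KLRegimeSplit

set_option linter.dupNamespace false -- summit = problem name (single-conjunct summit), D-0017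

open Real Set Filter Metric Complex
open scoped Topology
open Literature.MathematicalPhysics.QuantumLattice Literature.MathematicalPhysics.QuantumLattice.BandSectorCounting
open Summit.HubbardSuperconductivity.HubbardSuperconductivity.Theorems.PerturbedFermiCurve

/-! ## §0 Small facts -/

/-- The certificate's cutoff factor is in `[0, 1]`. -/
theorem abs_certCutoff_le_one (μ : ℝ) (r : ℝ → ℝ) (w : ℝ × ℝ) (ϑ : ℝ) : |certCutoff μ r w ϑ| ≤ 1 := by
  rw [certCutoff_apply]
  have h := klFlatCutoffFn_mem_Icc μ (WithLp.ofLp (certCurve r ϑ - jshift w))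
  rw [abs_le]; constructor <;> linarith [h.1, h.2]

/-- `|xᵏ − 1| ≤ k·e·(1+e)ᵏ` when `|x − 1| ≤ e`. -/
theorem abs_pow_sub_one_le {x e : ℝ} (hx : |x - 1| ≤ e) : ∀ k : ℕ, |x ^ k - 1| ≤ k * e * (1 + e) ^ k := by
  have he : 0 ≤ e := (abs_nonneg _).trans hx
  have hxa : |x| ≤ 1 + e := by
    calc |x| = |(x - 1) + 1| := by ring_nf
      _ ≤ |x - 1| + |1| := abs_add_le _ _
      _ ≤ e + 1 := by rw [abs_one]; linarith
      _ = 1 + e := by ring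
  intro k
  induction k with
  | zero => simp
  | succ n ih =>
    have e1 : x ^ (n + 1) - 1 = x * (x ^ n - 1) + (x - 1) := by ring
    have hp : 0 ≤ (1 + e) ^ n := by positivity
    have h1 : (1 : ℝ) ≤ (1 + e) ^ (n + 1) := one_le_pow₀ (by linarith)
    rw [e1]
    calc |x * (x ^ n - 1) + (x - 1)| ≤ |x * (x ^ n - 1)| + |x - 1| := abs_add_le _ _
      _ = |x| * |x ^ n - 1| + |x - 1| := by rw [abs_mul]
      _ ≤ (1 + e) * (n * e * (1 + e) ^ n) + e := by gcongr
      _ = n * e * (1 + e) ^ (n + 1) + e := by ring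
      _ ≤ n * e * (1 + e) ^ (n + 1) + e * (1 + e) ^ (n + 1) := by nlinarith
      _ = ((n + 1 : ℕ) : ℝ) * e * (1 + e) ^ (n + 1) := by push_cast; ring

/-! ## §1 Transfer: the certificate's displaced angle versus the chart -/

section Transfer

variable {r : ℝ → ℝ} (hr : ContDiff ℝ 4 r) {θ : ℝ} (hu : 0 < r θ) {δ₀ : ℝ} (hδ₀ : 0 ≤ δ₀) (hδu : 4 * δ₀ < r θ)
  (hfold : r θ + 2 * δ₀ < π) {w : ℝ × ℝ} (hw : |w.1| ≤ δ₀ ∧ |w.2| ≤ δ₀)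
include hw

/-- On the near square the displacement vector is short: `‖v_w‖ ≤ |s| + |t| ≤ 2δ₀`. -/
theorem norm_jshift_le_two_mul : ‖jshift w‖ ≤ 2 * δ₀ := (norm_jshift_le w).trans (by linarith [hw.1, hw.2])

include hu hδu in
/-- The displaced base point is not the origin. -/
theorem norm_displaced_pos : 0 < ‖certCurve r θ - jshift w‖ := by
  have h := norm_sub_norm_le (certCurve r θ) (jshift w)
  rw [norm_certCurve, abs_of_pos hu] at h
  linarith [norm_jshift_le_two_mul hw]

include hu hfold in
/-- **No fold on the near square**: every coordinate of the displaced base point is `< π` in absolute value. -/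
theorem abs_displaced_apply_lt_pi (i : Fin 2) : |WithLp.ofLp (certCurve r θ - jshift w) i| < π := by
  have h1 : |WithLp.ofLp (certCurve r θ - jshift w) i| ≤ ‖certCurve r θ - jshift w‖ := by
    have := PiLp.norm_apply_le (certCurve r θ - jshift w) i
    rwa [Real.norm_eq_abs] at this
  have h2 : ‖certCurve r θ - jshift w‖ ≤ r θ + 2 * δ₀ := by
    calc ‖certCurve r θ - jshift w‖ ≤ ‖certCurve r θ‖ + ‖jshift w‖ := norm_sub_le _ _
      _ ≤ r θ + 2 * δ₀ := by rw [norm_certCurve, abs_of_pos hu]; linarith [norm_jshift_le_two_mul hw]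
  linarith

include hr hu hδu hfold in
/-- **THE TRANSFER.**  If the displaced base point is off the cut (`⟨(certCurve r θ − v_w)₁⟩ ≠ 0`, k3c3-p1's a.e. condition), then near `θ`
the certificate's displaced angle IS the chart angle up to a constant multiple of `2π`. -/
theorem certAngle_eventuallyEq_rotArg (hslit : toIocMod Real.two_pi_pos (-π) (WithLp.ofLp (certCurve r θ - jshift w) 1) ≠ 0) :
    ∃ k : ℤ, certAngle r w =ᶠ[𝓝 θ] fun ϑ =>
      (θ + arg (momToComplex (WithLp.ofLp (certCurve r ϑ - jshift w)) * cexp (-(θ : ℂ) * I))) + k * (2 * π) := by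
  set q : ℝ → Momentum := fun ϑ => certCurve r ϑ - jshift w with hqdef
  set Ψ : Momentum → ℝ := fun p => θ + arg (momToComplex (WithLp.ofLp p) * cexp (-(θ : ℂ) * I)) with hΨdef
  have hqC : Continuous q := (contDiff_certCurve hr).continuous.sub continuous_const
  -- no fold, eventually
  have hlt : ∀ i, ∀ᶠ ϑ in 𝓝 θ, |WithLp.ofLp (q ϑ) i| < π := fun i => by
    have hc : Continuous fun ϑ => |WithLp.ofLp (q ϑ) i| :=
      ((continuous_apply i).comp ((PiLp.continuous_ofLp 2 _).comp hqC)).abs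
    exact hc.continuousAt.eventually (gt_mem_nhds (abs_displaced_apply_lt_pi hu hfold hw i))
  have hfoldev : ∀ᶠ ϑ in 𝓝 θ, centredRep (WithLp.ofLp (q ϑ)) = WithLp.ofLp (q ϑ) := by
    filter_upwards [hlt 0, hlt 1] with ϑ h0 h1
    exact centredRep_eq_self_of_abs_lt (by intro i; fin_cases i <;> assumption)
  -- the displaced base point is off the cut and off the origin
  have hq1 : WithLp.ofLp (q θ) 1 ≠ 0 := by
    have hself : toIocMod Real.two_pi_pos (-π) (WithLp.ofLp (q θ) 1) = WithLp.ofLp (q θ) 1 := by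
      rw [toIocMod_eq_self]
      have h := abs_lt.1 (abs_displaced_apply_lt_pi hu hfold hw 1)
      constructor <;> linarith [h.1, h.2]
    rw [← hself]; exact hslit
  have hnz : ∀ᶠ ϑ in 𝓝 θ, momToComplex (WithLp.ofLp (q ϑ)) ≠ 0 := by
    have hc : Continuous fun ϑ => ‖q ϑ‖ := hqC.norm
    have hpos := hc.continuousAt.eventually (lt_mem_nhds (norm_displaced_pos hu hδu hw))
    filter_upwards [hpos] with ϑ hϑ
    intro h0
    have : WithLp.ofLp (q ϑ) = 0 := (momToComplex_eq_zero_iff _).1 h0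
    have : q ϑ = 0 := by
      have := congrArg (WithLp.toLp 2) this; simpa using this
    rw [this, norm_zero] at hϑ; exact lt_irrefl _ hϑ
  -- continuity of both angle functions at `θ`
  have hcontP : ContinuousAt (fun ϑ => polarAngle (WithLp.ofLp (q ϑ))) θ :=
    ((contDiffAt_polarAngle_ofLp_of_ne (n := 0) hq1).continuousAt).comp hqC.continuousAt
  have hcontΨ : ContinuousAt (fun ϑ => Ψ (q ϑ)) θ := by
    have h := contDiffAt_rotArg_displaced hr (θ := θ) (w := jshift w)
      (by have := norm_jshift_le_two_mul hw; linarith)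
    exact h.continuousAt
  -- the integer-valued difference is locally constant
  set dfun : ℝ → ℝ := fun ϑ => Ψ (q ϑ) - polarAngle (WithLp.ofLp (q ϑ)) with hddef
  have hdint : ∀ᶠ ϑ in 𝓝 θ, ∃ k : ℤ, dfun ϑ = k * (2 * π) := by
    filter_upwards [hnz] with ϑ hϑ
    obtain ⟨k, hk⟩ := exists_rotArg_eq_polarAngle_add θ hϑ
    exact ⟨k, by simp only [hddef, hΨdef]; linarith⟩
  obtain ⟨k₀, hk₀⟩ : ∃ k : ℤ, dfun θ = k * (2 * π) := hdint.self_of_nhds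
  have hdcont : ContinuousAt dfun θ := hcontΨ.sub hcontP
  have hclose : ∀ᶠ ϑ in 𝓝 θ, |dfun ϑ - dfun θ| < 2 * π := by
    have h := (Metric.tendsto_nhds.1 hdcont) (2 * π) Real.two_pi_pos
    filter_upwards [h] with ϑ hϑ
    rwa [Real.dist_eq] at hϑ
  have hconst : ∀ᶠ ϑ in 𝓝 θ, dfun ϑ = k₀ * (2 * π) := by
    filter_upwards [hdint, hclose] with ϑ ⟨k, hk⟩ hcl
    rw [hk, hk₀, ← sub_mul, abs_mul, abs_of_pos Real.two_pi_pos] at hcl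
    have hk1 : |((k : ℝ) - k₀)| < 1 := by
      by_contra h; rw [not_lt] at h; nlinarith [Real.pi_pos]
    have : k = k₀ := by
      have h' : |((k - k₀ : ℤ) : ℝ)| < 1 := by push_cast; exact hk1
      rw [← Int.cast_abs] at h'
      have h'' : |k - k₀| < 1 := by exact_mod_cast h'
      exact sub_eq_zero.1 (Int.abs_lt_one_iff.1 h'')
    rw [hk, this]
  refine ⟨-k₀, ?_⟩
  filter_upwards [hfoldev, hconst] with ϑ hf hc
  rw [certAngle_apply, hf]
  simp only [hddef] at hc
  push_cast
  linarith

include hr hu hδu hfold in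
/-- **Jets transfer**: `∂ᵐ(certAngle r w)(θ) = ∂ᵐ[Ψ_θ(certCurve r · − v_w)](θ)` for `m ≥ 1` (off the cut). -/
theorem iteratedDeriv_certAngle_eq_rotArg (hslit : toIocMod Real.two_pi_pos (-π) (WithLp.ofLp (certCurve r θ - jshift w) 1) ≠ 0)
    {m : ℕ} (hm : 1 ≤ m) :
    iteratedDeriv m (certAngle r w) θ =
      iteratedDeriv m (fun ϑ : ℝ => θ + arg (momToComplex (WithLp.ofLp (certCurve r ϑ - jshift w)) * cexp (-(θ : ℂ) * I))) θ := by
  obtain ⟨k, hk⟩ := certAngle_eventuallyEq_rotArg hr hu hδu hfold hw hslit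
  rw [Filter.EventuallyEq.iteratedDeriv_eq m hk]
  have e : (fun ϑ : ℝ => (θ + arg (momToComplex (WithLp.ofLp (certCurve r ϑ - jshift w)) * cexp (-(θ : ℂ) * I))) + k * (2 * π)) =
      fun ϑ => (k * (2 * π) : ℝ) + (θ + arg (momToComplex (WithLp.ofLp (certCurve r ϑ - jshift w)) * cexp (-(θ : ℂ) * I))) := by
    funext ϑ; ring
  rw [e, iteratedDeriv_const_add (by omega)]

include hr hu hδu hfold in
/-- **Transport transfer**: `⟨certAngle r w θ − θ⟩ = Ψ_θ(certCurve r θ − v_w) − θ` (the chart difference lies in `(−π/2, π/2)`). -/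
theorem toIocMod_certAngle_sub_eq (hslit : toIocMod Real.two_pi_pos (-π) (WithLp.ofLp (certCurve r θ - jshift w) 1) ≠ 0) :
    toIocMod Real.two_pi_pos (-π) (certAngle r w θ - θ) =
      θ + arg (momToComplex (WithLp.ofLp (certCurve r θ - jshift w)) * cexp (-(θ : ℂ) * I)) - θ := by
  obtain ⟨k, hk⟩ := certAngle_eventuallyEq_rotArg hr hu hδu hfold hw hslit
  have hθ := hk.self_of_nhds
  have hsmall := (abs_rotArg_displaced_sub_le (r := r) (θ := θ) (δ := 2 * δ₀) (by linarith) (norm_jshift_le_two_mul hw)).2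
  rw [hθ, show θ + arg (momToComplex (WithLp.ofLp (certCurve r θ - jshift w)) * cexp (-(θ : ℂ) * I)) + k * (2 * π) - θ =
    (θ + arg (momToComplex (WithLp.ofLp (certCurve r θ - jshift w)) * cexp (-(θ : ℂ) * I)) - θ) + k • (2 * π) by
      rw [zsmul_eq_mul]; ring, toIocMod_add_zsmul, toIocMod_eq_self]
  have h := abs_lt.1 hsmall
  constructor <;> linarith [h.1, h.2, Real.pi_pos]

end Transfer

/-! ## §2 The near-field rows -/

section Rows

variable {r : ℝ → ℝ} (hr : ContDiff ℝ 4 r) {θ : ℝ} (hu : 0 < r θ) {δ₀ : ℝ} (hδ₀ : 0 ≤ δ₀) (hδu : 4 * δ₀ < r θ)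
  (hfold : r θ + 2 * δ₀ < π) {w : ℝ × ℝ} (hw : |w.1| ≤ δ₀ ∧ |w.2| ≤ δ₀)
  (hslit : toIocMod Real.two_pi_pos (-π) (WithLp.ofLp (certCurve r θ - jshift w) 1) ≠ 0)
  {D : ℕ → ℝ} (hD0 : ∀ i, 0 ≤ D i) (hD : ∀ i, 1 ≤ i → i ≤ 4 → ‖iteratedDeriv i (certCurve r) θ‖ ≤ D i)
  {ρ : ℝ} (hρ : 0 < ρ) (hρle : ρ ≤ r θ - 2 * δ₀)
include hr hu hδ₀ hδu hfold hw hslit hD0 hD hρ hρle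

/-- **NEAR-FIELD ANGULAR JETS of the certificate's displaced angle**: with `L = |s| + |t|`,
`|α′(θ) − 1| ≤ L·Λ₁`, `|α″(θ)| ≤ L·Λ₂`, `|α‴(θ)| ≤ L·Λ₃`, `|α⁗(θ)| ≤ L·Λ₄`, `Λ₁ = D₁/ρ²`, `Λ₂ = 2D₁²/ρ³ + D₂/ρ²`,
`Λ₃ = 6D₁³/ρ⁴ + 6D₁D₂/ρ³ + D₃/ρ²`, `Λ₄ = 24D₁⁴/ρ⁵ + 36D₁²D₂/ρ⁴ + (6D₂² + 8D₁D₃)/ρ³ + D₄/ρ²`, any `0 < ρ ≤ r θ − 2δ₀`. -/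
theorem certAngle_jets_near :
    |iteratedDeriv 1 (certAngle r w) θ - 1| ≤ (|w.1| + |w.2|) * (D 1 / ρ ^ 2) ∧
      |iteratedDeriv 2 (certAngle r w) θ| ≤ (|w.1| + |w.2|) * (2 * D 1 ^ 2 / ρ ^ 3 + D 2 / ρ ^ 2) ∧
      |iteratedDeriv 3 (certAngle r w) θ| ≤ (|w.1| + |w.2|) * (6 * D 1 ^ 3 / ρ ^ 4 + 6 * D 1 * D 2 / ρ ^ 3 + D 3 / ρ ^ 2) ∧
      |iteratedDeriv 4 (certAngle r w) θ| ≤ (|w.1| + |w.2|) *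
        (24 * D 1 ^ 4 / ρ ^ 5 + 36 * D 1 ^ 2 * D 2 / ρ ^ 4 + (6 * D 2 ^ 2 + 8 * D 1 * D 3) / ρ ^ 3 + D 4 / ρ ^ 2) := by
  have hL : ‖jshift w‖ ≤ |w.1| + |w.2| := norm_jshift_le w
  have hL2 : ‖jshift w‖ ≤ 2 * δ₀ := norm_jshift_le_two_mul hw
  obtain ⟨j1, j2, j3, j4⟩ := rotArg_displaced_jets_near hr hu (δ := 2 * δ₀) (by linarith) (by linarith) hL2 hD
  set σ := r θ - 2 * δ₀ with hσ
  have hσρ : ρ ≤ σ := hρle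
  have d1 := hD0 1; have d2 := hD0 2; have d3 := hD0 3; have d4 := hD0 4
  -- monotonicity in `ρ` of each `D/ρ^j`
  have hmono : ∀ {X : ℝ} (_ : 0 ≤ X) (j : ℕ), X / σ ^ j ≤ X / ρ ^ j := fun {X} hX j =>
    div_le_div_of_nonneg_left hX (pow_pos hρ j) (pow_le_pow_left₀ hρ.le hσρ j)
  have hL0 : 0 ≤ |w.1| + |w.2| := by positivity
  rw [iteratedDeriv_certAngle_eq_rotArg hr hu hδu hfold hw hslit le_rfl,
    iteratedDeriv_certAngle_eq_rotArg hr hu hδu hfold hw hslit (by norm_num : 1 ≤ 2),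
    iteratedDeriv_certAngle_eq_rotArg hr hu hδu hfold hw hslit (by norm_num : 1 ≤ 3),
    iteratedDeriv_certAngle_eq_rotArg hr hu hδu hfold hw hslit (by norm_num : 1 ≤ 4)]
  refine ⟨j1.trans ?_, j2.trans ?_, j3.trans ?_, j4.trans ?_⟩
  · have h1 := hmono d1 2
    calc ‖jshift w‖ * (D 1 / σ ^ 2) ≤ ‖jshift w‖ * (D 1 / ρ ^ 2) := mul_le_mul_of_nonneg_left h1 (norm_nonneg _)
      _ ≤ (|w.1| + |w.2|) * (D 1 / ρ ^ 2) := mul_le_mul_of_nonneg_right hL (by positivity)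
  · have h1 := hmono (show 0 ≤ 2 * D 1 ^ 2 by positivity) 3; have h2 := hmono d2 2
    calc ‖jshift w‖ * (2 * D 1 ^ 2 / σ ^ 3 + D 2 / σ ^ 2) ≤ ‖jshift w‖ * (2 * D 1 ^ 2 / ρ ^ 3 + D 2 / ρ ^ 2) :=
          mul_le_mul_of_nonneg_left (add_le_add h1 h2) (norm_nonneg _)
      _ ≤ (|w.1| + |w.2|) * (2 * D 1 ^ 2 / ρ ^ 3 + D 2 / ρ ^ 2) := mul_le_mul_of_nonneg_right hL (by positivity)
  · have h1 := hmono (show 0 ≤ 6 * D 1 ^ 3 by positivity) 4; have h2 := hmono (show 0 ≤ 6 * D 1 * D 2 by positivity) 3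
    have h3 := hmono d3 2
    calc ‖jshift w‖ * (6 * D 1 ^ 3 / σ ^ 4 + 6 * D 1 * D 2 / σ ^ 3 + D 3 / σ ^ 2)
        ≤ ‖jshift w‖ * (6 * D 1 ^ 3 / ρ ^ 4 + 6 * D 1 * D 2 / ρ ^ 3 + D 3 / ρ ^ 2) :=
          mul_le_mul_of_nonneg_left (by linarith) (norm_nonneg _)
      _ ≤ (|w.1| + |w.2|) * (6 * D 1 ^ 3 / ρ ^ 4 + 6 * D 1 * D 2 / ρ ^ 3 + D 3 / ρ ^ 2) :=
          mul_le_mul_of_nonneg_right hL (by positivity)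
  · have h1 := hmono (show 0 ≤ 24 * D 1 ^ 4 by positivity) 5; have h2 := hmono (show 0 ≤ 36 * D 1 ^ 2 * D 2 by positivity) 4
    have h3 := hmono (show 0 ≤ 6 * D 2 ^ 2 + 8 * D 1 * D 3 by positivity) 3; have h4 := hmono d4 2
    calc ‖jshift w‖ * (24 * D 1 ^ 4 / σ ^ 5 + 36 * D 1 ^ 2 * D 2 / σ ^ 4 + (6 * D 2 ^ 2 + 8 * D 1 * D 3) / σ ^ 3 + D 4 / σ ^ 2)
        ≤ ‖jshift w‖ * (24 * D 1 ^ 4 / ρ ^ 5 + 36 * D 1 ^ 2 * D 2 / ρ ^ 4 + (6 * D 2 ^ 2 + 8 * D 1 * D 3) / ρ ^ 3 + D 4 / ρ ^ 2) :=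
          mul_le_mul_of_nonneg_left (by linarith) (norm_nonneg _)
      _ ≤ (|w.1| + |w.2|) *
          (24 * D 1 ^ 4 / ρ ^ 5 + 36 * D 1 ^ 2 * D 2 / ρ ^ 4 + (6 * D 2 ^ 2 + 8 * D 1 * D 3) / ρ ^ 3 + D 4 / ρ ^ 2) :=
          mul_le_mul_of_nonneg_right hL (by positivity)

/-- **THE NEAR-FIELD `Tt`-ROWS** (lower Bell rows, `1 ≤ l < k ≤ 4`): with `L = |s| + |t|`, `ε = 2δ₀·Λ₁` and `Λ_m` as in `certAngle_jets_near`,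
`|χ_w(θ)|·P_{2,1} ≤ Λ₂L`, `|χ_w|·P_{3,1} ≤ Λ₃L`, `|χ_w|·P_{3,2} ≤ 3(1+ε)Λ₂L`, `|χ_w|·P_{4,1} ≤ Λ₄L`,
`|χ_w|·P_{4,2} ≤ (3·(2δ₀Λ₂)·Λ₂ + 4(1+ε)Λ₃)L`, `|χ_w|·P_{4,3} ≤ 6(1+ε)²Λ₂L`. -/
theorem certAngle_Tt_rows_near (μ : ℝ) :
    let Λ₁ : ℝ := D 1 / ρ ^ 2
    let Λ₂ : ℝ := 2 * D 1 ^ 2 / ρ ^ 3 + D 2 / ρ ^ 2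
    let Λ₃ : ℝ := 6 * D 1 ^ 3 / ρ ^ 4 + 6 * D 1 * D 2 / ρ ^ 3 + D 3 / ρ ^ 2
    let Λ₄ : ℝ := 24 * D 1 ^ 4 / ρ ^ 5 + 36 * D 1 ^ 2 * D 2 / ρ ^ 4 + (6 * D 2 ^ 2 + 8 * D 1 * D 3) / ρ ^ 3 + D 4 / ρ ^ 2
    let L : ℝ := |w.1| + |w.2|
    |certCutoff μ r w θ| * bellP 2 1 (certAngleJets r w θ) ≤ Λ₂ * L ∧
    |certCutoff μ r w θ| * bellP 3 1 (certAngleJets r w θ) ≤ Λ₃ * L ∧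
    |certCutoff μ r w θ| * bellP 3 2 (certAngleJets r w θ) ≤ 3 * (1 + 2 * δ₀ * Λ₁) * Λ₂ * L ∧
    |certCutoff μ r w θ| * bellP 4 1 (certAngleJets r w θ) ≤ Λ₄ * L ∧
    |certCutoff μ r w θ| * bellP 4 2 (certAngleJets r w θ) ≤ (3 * (2 * δ₀ * Λ₂) * Λ₂ + 4 * (1 + 2 * δ₀ * Λ₁) * Λ₃) * L ∧
    |certCutoff μ r w θ| * bellP 4 3 (certAngleJets r w θ) ≤ 6 * (1 + 2 * δ₀ * Λ₁) ^ 2 * Λ₂ * L := by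
  intro Λ₁ Λ₂ Λ₃ Λ₄ L
  obtain ⟨j1, j2, j3, j4⟩ := certAngle_jets_near hr hu hδ₀ hδu hfold hw hslit hD0 hD hρ hρle
  have d1 := hD0 1; have d2 := hD0 2; have d3 := hD0 3; have d4 := hD0 4
  have hΛ₁ : 0 ≤ Λ₁ := by positivity
  have hΛ₂ : 0 ≤ Λ₂ := by positivity
  have hΛ₃ : 0 ≤ Λ₃ := by positivity
  have hΛ₄ : 0 ≤ Λ₄ := by positivity
  have hL0 : 0 ≤ L := by positivity
  have hL2 : L ≤ 2 * δ₀ := by show |w.1| + |w.2| ≤ 2 * δ₀; linarith [hw.1, hw.2]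
  have hχ := abs_certCutoff_le_one μ r w θ
  have hχ0 : 0 ≤ |certCutoff μ r w θ| := abs_nonneg _
  -- the jets `X m = |∂ᵐα|`
  have X1 : certAngleJets r w θ 1 ≤ 1 + L * Λ₁ := by
    show |iteratedDeriv 1 (certAngle r w) θ| ≤ 1 + L * Λ₁
    calc |iteratedDeriv 1 (certAngle r w) θ| = |(iteratedDeriv 1 (certAngle r w) θ - 1) + 1| := by ring_nf
      _ ≤ |iteratedDeriv 1 (certAngle r w) θ - 1| + |1| := abs_add_le _ _
      _ ≤ L * Λ₁ + 1 := by rw [abs_one]; exact add_le_add j1 le_rfl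
      _ = 1 + L * Λ₁ := by ring
  have hLΛ₁ : L * Λ₁ ≤ 2 * δ₀ * Λ₁ := mul_le_mul_of_nonneg_right hL2 hΛ₁
  have hLΛ₂ : L * Λ₂ ≤ 2 * δ₀ * Λ₂ := mul_le_mul_of_nonneg_right hL2 hΛ₂
  have X1' : certAngleJets r w θ 1 ≤ 1 + 2 * δ₀ * Λ₁ := X1.trans (by linarith)
  have X2 : certAngleJets r w θ 2 ≤ L * Λ₂ := j2
  have X3 : certAngleJets r w θ 3 ≤ L * Λ₃ := j3
  have X4 : certAngleJets r w θ 4 ≤ L * Λ₄ := j4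
  have X2' : certAngleJets r w θ 2 ≤ 2 * δ₀ * Λ₂ := X2.trans hLΛ₂
  have hX0 : ∀ m, 0 ≤ certAngleJets r w θ m := certAngleJets_nonneg r w θ
  have x1 := hX0 1; have x2 := hX0 2; have x3 := hX0 3
  -- each row: `|χ| ≤ 1` times the Bell monomial
  have row : ∀ {P B : ℝ}, 0 ≤ P → P ≤ B → |certCutoff μ r w θ| * P ≤ B := fun {P B} hP hPB =>
    calc |certCutoff μ r w θ| * P ≤ 1 * P := mul_le_mul_of_nonneg_right hχ hP
      _ = P := one_mul P
      _ ≤ B := hPB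
  refine ⟨row (bellP_nonneg hX0 2 1) ?_, row (bellP_nonneg hX0 3 1) ?_, row (bellP_nonneg hX0 3 2) ?_, row (bellP_nonneg hX0 4 1) ?_,
    row (bellP_nonneg hX0 4 2) ?_, row (bellP_nonneg hX0 4 3) ?_⟩
  · show certAngleJets r w θ 2 ≤ Λ₂ * L; linarith
  · show certAngleJets r w θ 3 ≤ Λ₃ * L; linarith
  · show 3 * certAngleJets r w θ 1 * certAngleJets r w θ 2 ≤ 3 * (1 + 2 * δ₀ * Λ₁) * Λ₂ * L
    calc 3 * certAngleJets r w θ 1 * certAngleJets r w θ 2 ≤ 3 * (1 + 2 * δ₀ * Λ₁) * (L * Λ₂) := by gcongr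
      _ = 3 * (1 + 2 * δ₀ * Λ₁) * Λ₂ * L := by ring
  · show certAngleJets r w θ 4 ≤ Λ₄ * L; linarith
  · show 3 * certAngleJets r w θ 2 ^ 2 + 4 * certAngleJets r w θ 1 * certAngleJets r w θ 3 ≤
      (3 * (2 * δ₀ * Λ₂) * Λ₂ + 4 * (1 + 2 * δ₀ * Λ₁) * Λ₃) * L
    have h1 : certAngleJets r w θ 2 ^ 2 ≤ (2 * δ₀ * Λ₂) * (L * Λ₂) := by
      rw [sq]; exact mul_le_mul X2' X2 x2 (by positivity)
    have h2 : certAngleJets r w θ 1 * certAngleJets r w θ 3 ≤ (1 + 2 * δ₀ * Λ₁) * (L * Λ₃) :=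
      mul_le_mul X1' X3 x3 (by positivity)
    calc 3 * certAngleJets r w θ 2 ^ 2 + 4 * certAngleJets r w θ 1 * certAngleJets r w θ 3
        ≤ 3 * ((2 * δ₀ * Λ₂) * (L * Λ₂)) + 4 * ((1 + 2 * δ₀ * Λ₁) * (L * Λ₃)) := by linarith
      _ = (3 * (2 * δ₀ * Λ₂) * Λ₂ + 4 * (1 + 2 * δ₀ * Λ₁) * Λ₃) * L := by ring
  · show 6 * certAngleJets r w θ 1 ^ 2 * certAngleJets r w θ 2 ≤ 6 * (1 + 2 * δ₀ * Λ₁) ^ 2 * Λ₂ * L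
    have h1 : certAngleJets r w θ 1 ^ 2 ≤ (1 + 2 * δ₀ * Λ₁) ^ 2 := pow_le_pow_left₀ x1 X1' 2
    calc 6 * certAngleJets r w θ 1 ^ 2 * certAngleJets r w θ 2 ≤ 6 * (1 + 2 * δ₀ * Λ₁) ^ 2 * (L * Λ₂) := by gcongr
      _ = 6 * (1 + 2 * δ₀ * Λ₁) ^ 2 * Λ₂ * L := by ring

/-- **THE NEAR-FIELD `Tu`-ROWS** (top Bell coefficient): `|χ_w(θ)|·|α′(θ)ᵏ − 1| ≤ k·Λ₁·(1 + 2δ₀Λ₁)ᵏ·(|s| + |t|)`. -/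
theorem certAngle_Tu_rows_near (μ : ℝ) (k : ℕ) :
    |certCutoff μ r w θ| * |iteratedDeriv 1 (certAngle r w) θ ^ k - 1| ≤
      k * (D 1 / ρ ^ 2) * (1 + 2 * δ₀ * (D 1 / ρ ^ 2)) ^ k * (|w.1| + |w.2|) := by
  obtain ⟨j1, -, -, -⟩ := certAngle_jets_near hr hu hδ₀ hδu hfold hw hslit hD0 hD hρ hρle
  have d1 := hD0 1
  have hL2 : |w.1| + |w.2| ≤ 2 * δ₀ := by linarith [hw.1, hw.2]
  set e := (|w.1| + |w.2|) * (D 1 / ρ ^ 2) with he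
  have he0 : 0 ≤ e := by positivity
  have h := abs_pow_sub_one_le j1 k
  have hχ := abs_certCutoff_le_one μ r w θ
  have hek : (1 + e) ^ k ≤ (1 + 2 * δ₀ * (D 1 / ρ ^ 2)) ^ k := by
    apply pow_le_pow_left₀ (by positivity)
    have : e ≤ 2 * δ₀ * (D 1 / ρ ^ 2) := by rw [he]; exact mul_le_mul_of_nonneg_right hL2 (by positivity)
    linarith
  calc |certCutoff μ r w θ| * |iteratedDeriv 1 (certAngle r w) θ ^ k - 1|
      ≤ 1 * (k * e * (1 + e) ^ k) := mul_le_mul hχ h (abs_nonneg _) zero_le_one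
    _ ≤ k * e * (1 + 2 * δ₀ * (D 1 / ρ ^ 2)) ^ k := by rw [one_mul]; gcongr
    _ = k * (D 1 / ρ ^ 2) * (1 + 2 * δ₀ * (D 1 / ρ ^ 2)) ^ k * (|w.1| + |w.2|) := by rw [he]; ring

omit hδ₀ hD0 hD hρ hρle in
/-- **THE NEAR-FIELD `Td`-ROW** (transport of the argument): `|χ_w(θ)|·|⟨α_w(θ) − θ⟩| ≤ |−sin θ·s + cos θ·t|/(r θ − 2δ₀)` — only the
TANGENTIAL component of the displacement moves the angle. -/
theorem certAngle_Td_row_near (μ : ℝ) :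
    |certCutoff μ r w θ| * |toIocMod Real.two_pi_pos (-π) (certAngle r w θ - θ)| ≤
      |-Real.sin θ * w.1 + Real.cos θ * w.2| / (r θ - 2 * δ₀) := by
  have hχ := abs_certCutoff_le_one μ r w θ
  rw [toIocMod_certAngle_sub_eq hr hu hδu hfold hw hslit]
  have h := (abs_rotArg_displaced_sub_le (r := r) (θ := θ) (δ := 2 * δ₀) (by linarith) (norm_jshift_le_two_mul hw)).1
  have e : |WithLp.ofLp (jshift w) 1 * Real.cos θ - WithLp.ofLp (jshift w) 0 * Real.sin θ| = |-Real.sin θ * w.1 + Real.cos θ * w.2| := by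
    congr 1; simp; ring
  rw [e] at h
  calc _ ≤ 1 * |θ + arg (momToComplex (WithLp.ofLp (certCurve r θ - jshift w)) * cexp (-(θ : ℂ) * I)) - θ| :=
        mul_le_mul_of_nonneg_right hχ (abs_nonneg _)
    _ ≤ _ := by rw [one_mul]; exact h

end Rows

end Summit.HubbardSuperconductivity.HubbardSuperconductivity.Theorems.KLRegimeSplit

end
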